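import Summits.CriticalPhenomena.PercolationContinuityZ3.Theorems.Transplant.SkelPhiConcFaceRegion
import Summits.CriticalPhenomena.PercolationContinuityZ3.Theorems.Transplant.SkelPhiCellsConcGLevels
import Summits.CriticalPhenomena.PercolationContinuityZ3.Theorems.Transplant.SkelPhiConcExcess
import Summits.CriticalPhenomena.PercolationContinuityZ3.Theorems.Transplant.SkelConcFaceStep
import HarnessLib

/-!
# D″ node, (F) part 2 at φ-level (DPRIME-SCOPE §2 L6′, hp-8 column): the LAW of the face step is a subbox weighting of the window graph —
# over the two-unit cell geometry of record `Skelφ.cellGeomSG G φ P w₀ Λ` (p2-g7) and an arbitrary lag-1 anchored scheme `S : KSchA V ℕ`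
# with `hΓ : S.Γ = Skelφ.cellGeomSG G φ P w₀ Λ` — φ-level re-cut of `SkelConcFaceStep` §2–§3 (hp-8 g24, p235068) with `PCells ↦ PCells2`;
# its §1 (`KSchA.Wt_eq_zero_of_not_mem_edgeSet`) and the Φ-free scheme lemmas (`Skel.isSubbox_Wt_win`, `KSchA.du_ne_rev₂`,
# `KSchA.root_not_mem_of_fresh`, `Valid₂.sep_habitat`) are IMPORTED; the rim excess is discharged by the φ-level `Skelφ.real_rim_le_of_radius`

builds on p205010 (kernel theorem, internal audit signed; external expert review pending) — nothing in this file uses p205010.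
Lane `prim-bschramm`, seat `prim-hp-8` (gen 30; L6′ (F) owner); helper file (`--supports stmt-CriticalPhenomena-4575`).  Hypotheses through
p3-g7's dictionary (DPRIME-SCOPE addendum K): `hlip : Skelφ.Lip G φ` (level geometry, separations) and `hstep : Skelφ.Steps G φ` (the root's
step neighbour inside spans); `P : PCells2`, `Λ : ConcRadiiG`, `hΛ : Skelφ.WFS2 P Λ` explicit (p2-g7's records `levelGeomSG`/`qSepGeomSG`).
Port remarks (design events D1/D2 of FROM-prim-hp-8-g26-F-CHAIN-MAP §2 untouched): `hout` of `Skel.isSubbox_Wt_win` by SEPARATION (`LevelGeom.Btw_sep_Efar`,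
`Valid₂.sep_habitat`, `Skelφ.sep_Q_Win_farAS`), window depth `rE_{a'}(x,du)` exactly for the face-step window, `R ≥ rE, rQ_a(x)` on the maximal
fresh region; planar diameter of `E^far` is `50 rmax` (two units: `EfarN ⊆ cen x ± 25 (r₀, r₁)`).
* §1 planar: `PCells2.sub_mem_box_of_mem_EfarN` (`50 rmax`);
* §2 **`isSubbox_Wt_fresh`**, **`isSubbox_Wt_faceWin`**, `Win_farAS_subset_Sx`, `root_not_mem_Win_farAS`, `Efar_disjoint_Ewv'`;
* §3 **`entrance_faceFresh`** (depth `≤ R₀ + 1`), **`rim_excess_face`** (`P_{Wt}(⋃_{t ∈ Rim} w₀ ↔ t) ≤ η` from an excess radius `R₁ ≤ Rt − L'`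
  at the running parameter, centre `w₀`, entrance depth `R₀ + 1`, planar diameter `50 rmax` — NO instance bridge: `Skelφ.real_rim_le_of_radius`
  takes the subbox at the ambient `DecidableEq`).
Call sites port from `Skel.*` by `Φ ↦ hlip hstep` (resp. the sublist used), `C ↦ P`, `50 * C.r ↦ 50 * P.rmax` (K2.2).
[cite: KozmaNitzan2024, §4 p. 27 ((30)), p. 30 (Step III), p. 31 (D is a subbox of Ω), Lemma 12 (p. 24)] [cite: MartineauSevero2019, Cor. 2.2]
-/

noncomputable section

open MeasureTheory
open scoped Classical

namespace Summit.CriticalPhenomena.PercolationContinuityZ3.Theorems.Transplant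

open Literature.Probability.Percolation Literature.Probability.LatticeModels SimpleGraph KNCells KNLevels GadgetSystem Contour
open Literature.Probability.Percolation.KozmaNitzan
open Literature.Probability.Percolation.KozmaNitzan.Cells (oth oth_ne sgOf sgOf_sign stepVec_apply_fst stepVec_apply_oth eq_oth_of_ne oth_oth)
open Literature.Barriers.CriticalPhenomena (graphBall graphBall_finite mem_graphBall_self graphBall_mono)
open BoxProdZ2 (ConcRadiiG mem_graphBall_succ_of_adj)
open Skel (winGraph)

/-! ## §1 Planar supplement: the diameter of the far rows, two units -/

namespace PCells2

/-- Points of `EfarN x du` differ by at most `50 rmax` in every coordinate (`EfarN ⊆ cen x ± 25 (r₀, r₁)`, `r_i ≤ rmax`). [folklore] -/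
theorem sub_mem_box_of_mem_EfarN (P : PCells2) {x : Site 2} {du : MDir} {t t' : Site 2} (ht : t ∈ P.EfarN x du)
    (ht' : t' ∈ P.EfarN x du) : t - t' ∈ box 2 (50 * P.rmax) := by
  have h1 := (P.mem_abox_iff).1 (P.EfarN_subset_abox x du ht)
  have h2 := (P.mem_abox_iff).1 (P.EfarN_subset_abox x du ht')
  rw [mem_box]
  intro i
  have hi1 := h1 i
  have hi2 := h2 i
  have hr : P.r i ≤ P.rmax := P.r_le_rmax i
  have hr' : ((25 * P.r i : ℕ) : ℤ) ≤ 25 * (P.rmax : ℤ) := by exact_mod_cast Nat.mul_le_mul_left 25 hr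
  simp only [Pi.sub_apply]
  push_cast at hi1 hi2 hr' ⊢
  constructor <;> linarith [hi1.1, hi1.2, hi2.1, hi2.2]

end PCells2

/-! ## §2 The two subbox facts of the face step -/

namespace Skelφ

variable {V : Type} [DecidableEq V] {G : SimpleGraph V} [G.LocallyFinite] {φ : V → Site 2}
variable {P : PCells2} {w₀ : V} {Λ : ConcRadiiG} {S : KSchA V ℕ}
variable (hΓ : S.Γ = cellGeomSG G φ P w₀ Λ) (hΛ : WFS2 P Λ)
variable {h : ProbeHistory V} {e : Site 2 × MDir} (hV : S.Valid₂ G h e) {a a' : ℕ} {du : MDir} (hdu : du ∈ S.onward G h (tgt e))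
variable {j : ℕ} {o : Finset (Sym2 V)}

/-- `E^far_{a'}(w + δw, du)` misses `E_{w,v}` of the incoming edge when `du` is not the way back (planar footprints; two units).
[cite: KozmaNitzan2024, §4 p. 26] -/
theorem Efar_disjoint_Ewv' (a a' : ℕ) (w : Site 2) {δw du : MDir} (hne : du ≠ rev δw) :
    Disjoint ((cellGeomSG G φ P w₀ Λ).Efar a' (w + stepVec δw) du) ((cellGeomSG G φ P w₀ Λ).Ewv a w δw) := by
  have h := P.EwvN_disjoint_EfarN w hne
  rw [PCells2.EwvN, Finset.disjoint_union_left] at h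
  change Disjoint (VWin G φ w₀ (P.EfarN (w + stepVec δw) du) (Λ.rE a' (w + stepVec δw) du))
    (VWin G φ w₀ (P.BtwN w δw) (Λ.rB a w δw) ∪ VWin G φ w₀ (P.Q (w + stepVec δw)) (Λ.rQ a (w + stepVec δw)))
  rw [Finset.disjoint_union_right]
  exact ⟨disjoint_VWin h.1.symm _ _, disjoint_VWin h.2.symm _ _⟩

include hΓ hΛ hV hdu

/-- **Every `Dd ⊆ E^far_{a'}(x, du)` missing `Stub_j` is a subbox of `Wt` in the window graph of any depth `R ≥ rE_{a'}(x,du), rQ_a(x)`**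
(the explored region and the between-box span are `G`-separated from `E^far`; a cube-span neighbour has depth `≤ rQ_a(x)`, a far-region
neighbour depth `≤ rE`) (φ-level, from `Lip`). [cite: KozmaNitzan2024, §4 p. 31 (D is a subbox of Ω)] -/
theorem isSubbox_Wt_fresh (hlip : Lip G φ) {R : ℕ} (hE : Λ.rE a' (tgt e) du ≤ R) (hQ : Λ.rQ a (tgt e) ≤ R) {Dd : Finset V}
    (hDd : Dd ⊆ S.Γ.Efar a' (tgt e) du) (hdS : Disjoint Dd (S.Γ.Stub a' (tgt e) du j)) :
    KNLevels.IsSubbox (winGraph G w₀ R) (S.Wt G h e a a' du j o) S.p Dd := by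
  obtain ⟨Γ, p, δc⟩ := S
  cases hΓ
  have hne : du ≠ rev e.2 := KSchA.du_ne_rev₂ hV hdu
  have hL := levelGeomSG P w₀ hΛ hlip
  refine Skel.isSubbox_Wt_win G w₀ R hL (qSepGeomSG P w₀ hlip) hV hdu (b := a) (hDd.trans Finset.subset_union_right)
    (fun u hu => by unfold KSchA.Sx; exact Finset.mem_union_right _ (hDd hu)) ?_ ?_ ?_
  · exact Finset.disjoint_union_right.2
      ⟨(Efar_disjoint_Ewv' a a' e.1 hne).mono_left hDd, hdS⟩
  · intro u hu
    have hu' : u ∈ VWin G φ w₀ (P.EfarN (tgt e) du) (Λ.rE a' (tgt e) du) := hDd hu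
    exact graphBall_mono G w₀ hE (mem_graphBall_of_mem_VWin hu')
  · intro v hv x hx hadj
    rcases Finset.mem_union.1 hx with hx | hx
    · rw [CellGeom.Ewv] at hx
      rcases Finset.mem_union.1 hx with hx | hx
      · exact absurd hadj (hL.Btw_sep_Efar a a' e.1 e.2 du hne x hx v (hDd hv)).2
      · have hx' : x ∈ VWin G φ w₀ (P.Q (e.1 + stepVec e.2)) (Λ.rQ a (e.1 + stepVec e.2)) := hx
        exact graphBall_mono G w₀ hQ (mem_graphBall_of_mem_VWin hx')
    · have hx' : x ∈ VWin G φ w₀ (P.EfarN (tgt e) du) (Λ.rE a' (tgt e) du) := hx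
      exact graphBall_mono G w₀ hE (mem_graphBall_of_mem_VWin hx')

/-- **The face-step window `Win w₀ (farAS x du j) rE` is a subbox of `Wt` in the window graph of depth `rE = rE_{a'}(x, du)`** — no hypothesis
on `rB`, `rQ`: nothing of `E_{w,v}` is `G`-adjacent to it (φ-level, from `Lip` and `Steps`). [cite: KozmaNitzan2024, §4 p. 31, p. 30 (Step III)] -/
theorem isSubbox_Wt_faceWin (hlip : Lip G φ) (hstep : Steps G φ) :
    KNLevels.IsSubbox (winGraph G w₀ (Λ.rE a' (tgt e) du)) (S.Wt G h e a a' du j o) S.p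
      (Win G φ w₀ (P.farAS (tgt e) du j) (Λ.rE a' (tgt e) du)) := by
  obtain ⟨Γ, p, δc⟩ := S
  cases hΓ
  have hne : du ≠ rev e.2 := KSchA.du_ne_rev₂ hV hdu
  have hL := levelGeomSG P w₀ hΛ hlip
  have hDd : Win G φ w₀ (P.farAS (tgt e) du j) (Λ.rE a' (tgt e) du) ⊆ (cellGeomSG G φ P w₀ Λ).Efar a' (tgt e) du :=
    Win_farAS_subset_Efar P w₀ hlip hstep (le_trans (by omega) (hΛ.ρE1 a' (tgt e) du 0)) j
  refine Skel.isSubbox_Wt_win G w₀ _ hL (qSepGeomSG P w₀ hlip) hV hdu (b := a) (hDd.trans Finset.subset_union_right)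
    (fun u hu => by unfold KSchA.Sx; exact Finset.mem_union_right _ (hDd hu)) ?_ (fun u hu => ((mem_Win G φ).1 hu).1) ?_
  · exact Finset.disjoint_union_right.2
      ⟨disjoint_Win_farAS_Ewv P w₀ a e.1 hne j _, disjoint_Win_farAS_Stub P w₀ a' (tgt e) du j _⟩
  · intro v hv x hx hadj
    rcases Finset.mem_union.1 hx with hx | hx
    · rw [CellGeom.Ewv] at hx
      rcases Finset.mem_union.1 hx with hx | hx
      · exact absurd hadj (hL.Btw_sep_Efar a a' e.1 e.2 du hne x hx v (hDd hv)).2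
      · exact absurd hadj (sep_Q_Win_farAS P w₀ hlip a (tgt e) du j _ x hx v hv).2
    · have hx' : x ∈ VWin G φ w₀ (P.EfarN (tgt e) du) (Λ.rE a' (tgt e) du) := hx
      exact mem_graphBall_of_mem_VWin hx'

omit hV hdu in
/-- The face-step window lies in the support `Sx = E_i ∪ E_{w,v} ∪ E^far` of `Wt` (from `Lip` and `Steps`). [folklore] -/
theorem Win_farAS_subset_Sx (hlip : Lip G φ) (hstep : Steps G φ) :
    Win G φ w₀ (P.farAS (tgt e) du j) (Λ.rE a' (tgt e) du) ⊆ S.Sx G h e a a' du := by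
  obtain ⟨Γ, p, δc⟩ := S
  cases hΓ
  intro u hu
  unfold KSchA.Sx
  exact Finset.mem_union_right _ (Win_farAS_subset_Efar P w₀ hlip hstep (le_trans (by omega) (hΛ.ρE1 a' (tgt e) du 0)) j hu)

/-- The root lies off the face-step window (it is explored; the window is fresh) (from `Lip` and `Steps`). [folklore] -/
theorem root_not_mem_Win_farAS (hlip : Lip G φ) (hstep : Steps G φ) :
    S.Γ.root ∉ Win G φ w₀ (P.farAS (tgt e) du j) (Λ.rE a' (tgt e) du) := by
  obtain ⟨Γ, p, δc⟩ := S
  cases hΓ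
  exact KSchA.root_not_mem_of_fresh (levelGeomSG P w₀ hΛ hlip) (qSepGeomSG P w₀ hlip) hV hdu (a := a')
    ((Win_farAS_subset_Efar P w₀ hlip hstep (le_trans (by omega) (hΛ.ρE1 a' (tgt e) du 0)) j).trans Finset.subset_union_right)

/-! ## §3 Entrances into the maximal fresh region are deep; the rim excess -/

/-- **Entrances into `E^far ∖ Stub_j` are deep**: a positive-weight edge of `Wt` from outside `E^far_{a'}(x,du) ∖ Stub_j` into it starts in
the cube span `Q_a(x)` or in the stub span (the explored region and the between-box span are `G`-separated from `E^far`), so it lands at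
depth `≤ R₀ + 1` once `R₀ ≥ rQ_a(x)` and `R₀ ≥` the stub profile `ρ_{a'}(x, du, ·)` (from `Lip`). [cite: KozmaNitzan2024, §4 pp. 26, 31] -/
theorem entrance_faceFresh (hlip : Lip G φ) {R₀ : ℕ} (hQ : Λ.rQ a (tgt e) ≤ R₀) (hρ : ∀ ℓ, Λ.ρ a' (tgt e) du ℓ ≤ R₀) {y b : V}
    (hy : y ∉ S.Γ.Efar a' (tgt e) du \ S.Γ.Stub a' (tgt e) du j) (hb : b ∈ S.Γ.Efar a' (tgt e) du \ S.Γ.Stub a' (tgt e) du j)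
    (hadj : G.Adj y b) (hw : S.Wt G h e a a' du j o s(y, b) ≠ 0) : b ∈ graphBall G w₀ (R₀ + 1) := by
  obtain ⟨Γ, p, δc⟩ := S
  cases hΓ
  have hne : du ≠ rev e.2 := KSchA.du_ne_rev₂ hV hdu
  have hL := levelGeomSG P w₀ hΛ hlip
  have hbE : b ∈ (cellGeomSG G φ P w₀ Λ).Efar a' (tgt e) du := (Finset.mem_sdiff.1 hb).1
  -- the pair lies inside the support `Sx`
  have hm : s(y, b) ∈ wireSet (↑(KSchA.Sx G ⟨cellGeomSG G φ P w₀ Λ, p, δc⟩ h e a a' du) : Set V) := by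
    by_contra hm; exact hw (KSchA.Wt_apply_of_not_mem_wireSet hm)
  have hyS : y ∈ KSchA.Sx G ⟨cellGeomSG G φ P w₀ Λ, p, δc⟩ h e a a' du := Finset.mem_coe.1 (mk_mem_wireSet_iff.1 hm).1
  unfold KSchA.Sx at hyS
  rcases Finset.mem_union.1 hyS with hyS | hyE
  · rcases Finset.mem_union.1 hyS with hyV | hyW
    · -- explored: separated from the habitat
      exact absurd hadj (KSchA.Valid₂.sep_habitat hL (qSepGeomSG P w₀ hlip) hV hdu (a := a) (a' := a') y hyV b
        (Finset.mem_union_right _ hbE)).2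
    · rw [CellGeom.Ewv] at hyW
      rcases Finset.mem_union.1 hyW with hyB | hyQ
      · -- between-box span: separated from `E^far`
        exact absurd hadj (hL.Btw_sep_Efar a a' e.1 e.2 du hne y hyB b hbE).2
      · -- cube span: depth `≤ rQ_a(x)`
        have hyQ' : y ∈ VWin G φ w₀ (P.Q (e.1 + stepVec e.2)) (Λ.rQ a (e.1 + stepVec e.2)) := hyQ
        exact mem_graphBall_succ_of_adj G (graphBall_mono G w₀ hQ (mem_graphBall_of_mem_VWin hyQ')) hadj
  · -- in `E^far` but not fresh: in the stub span, depth `≤ ρ`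
    have hySt : y ∈ (cellGeomSG G φ P w₀ Λ).Stub a' (tgt e) du j := by
      by_contra h'; exact hy (Finset.mem_sdiff.2 ⟨hyE, h'⟩)
    have hySt' : y ∈ VStair G φ w₀ (P.Stub (tgt e) du j) (prof P Λ a' (tgt e) du) := hySt
    exact mem_graphBall_succ_of_adj G (graphBall_mono G w₀ (hρ _) (mem_of_mem_VStair hySt').2) hadj

/-- **The rim excess of the face step is `≤ η`.**  With `Rim = {v ∈ Win w₀ (farAS x du j) rE : v ∉ B_G(w₀, Rt − L')}`, an entrance depth
`R₀ ≥ rQ_a(x), sup ρ_{a'}(x,du,·)`, and `R₁ ≤ Rt − L'` an excess radius at the running parameter for the centre `w₀`, entrance depth `R₀ + 1` and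
planar diameter `50 rmax` (the conclusion of `Skelφ.exists_excess_radius`, or of `Skelφ.exists_excess_radius_uniform` at `w₀`):
`P_{Wt}(⋃_{t ∈ Rim} w₀ ↔ t) ≤ η`.  The habitat of the excess event is the maximal fresh region `E^far ∖ Stub_j`, a subbox in the window graph of
depth `max(rE, rQ_a(x))` (from `Lip` and `Steps`). [cite: KozmaNitzan2024, §4 Lemma 12 (p. 24)] [cite: MartineauSevero2019, Cor. 2.2] -/
theorem rim_excess_face [Countable V] (hlip : Lip G φ) (hstep : Steps G φ) {R₀ : ℕ} (hQ : Λ.rQ a (tgt e) ≤ R₀)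
    (hρ : ∀ ℓ, Λ.ρ a' (tgt e) du ℓ ≤ R₀) {Rt L' : ℕ} {η : ℝ} {R₁ : ℕ}
    (hR₁ : ∀ R', R₁ ≤ R' → ∀ (Rw : ℕ) (D' A' : Finset V), (∀ d ∈ D', d ∈ graphBall G w₀ Rw) →
      (∀ d ∈ D', ∀ d' ∈ D', φ d - φ d' ∈ box 2 (50 * P.rmax)) → A' ⊆ D' → (∀ a ∈ A', a ∈ graphBall G w₀ (R₀ + 1)) →
        (bondPercolation G S.p).real (Skel.excess G w₀ R' D' A') ≤ η)
    (hR : R₁ ≤ Rt - L') :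
    (prodBernoulli (S.Wt G h e a a' du j o)).real
      (⋃ t ∈ (Win G φ w₀ (P.farAS (tgt e) du j) (Λ.rE a' (tgt e) du)).filter (fun v => v ∉ graphBall G w₀ (Rt - L')),
        openConn w₀ t) ≤ η := by
  obtain ⟨Γ, p, δc⟩ := S
  cases hΓ
  -- the habitat: the maximal fresh region, a subbox in the window graph of depth `max(rE, rQ_a(x))`
  set R := max (Λ.rE a' (tgt e) du) (Λ.rQ a (tgt e)) with hRdef
  set D : Finset V := (cellGeomSG G φ P w₀ Λ).Efar a' (tgt e) du \ (cellGeomSG G φ P w₀ Λ).Stub a' (tgt e) du j with hD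
  have hDE : D ⊆ (cellGeomSG G φ P w₀ Λ).Efar a' (tgt e) du := Finset.sdiff_subset
  have hDE' : D ⊆ VWin G φ w₀ (P.EfarN (tgt e) du) (Λ.rE a' (tgt e) du) := hDE
  have hWD := isSubbox_Wt_fresh (S := ⟨cellGeomSG G φ P w₀ Λ, p, δc⟩) rfl hΛ hV hdu (j := j) (o := o) hlip
    (show Λ.rE a' (tgt e) du ≤ R from le_max_left _ _) (show Λ.rQ a (tgt e) ≤ R from le_max_right _ _) hDE Finset.sdiff_disjoint
  have hA : ∀ y b, y ∉ D → b ∈ D → G.Adj y b → KSchA.Wt G ⟨cellGeomSG G φ P w₀ Λ, p, δc⟩ h e a a' du j o s(y, b) ≠ 0 →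
      b ∈ graphBall G w₀ (R₀ + 1) :=
    fun y b hy hb hadj hw => entrance_faceFresh (S := ⟨cellGeomSG G φ P w₀ Λ, p, δc⟩) rfl hΛ hV hdu hlip hQ hρ hy hb hadj hw
  have hRg : Win G φ w₀ (P.farAS (tgt e) du j) (Λ.rE a' (tgt e) du) ⊆ D := fun u hu =>
    Finset.mem_sdiff.2 ⟨Win_farAS_subset_Efar P w₀ hlip hstep (le_trans (by omega) (hΛ.ρE1 a' (tgt e) du 0)) j hu,
      Finset.disjoint_left.1 (disjoint_Win_farAS_Stub P w₀ a' (tgt e) du j _) hu⟩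
  have hDπ : ∀ v ∈ D, v ∈ graphBall G w₀ R := fun v hv =>
    graphBall_mono G w₀ (le_max_left _ _) (mem_graphBall_of_mem_VWin (hDE' hv))
  have hroot : w₀ ∉ D := KSchA.root_not_mem_of_fresh (S := ⟨cellGeomSG G φ P w₀ Λ, p, δc⟩)
    (levelGeomSG P w₀ hΛ hlip) (qSepGeomSG P w₀ hlip) hV hdu (a := a) (hDE.trans Finset.subset_union_right)
  refine real_rim_le_of_radius hWD hDπ (fun e' he' => KSchA.Wt_eq_zero_of_not_mem_edgeSet he') hroot
    ((Finset.filter_subset _ _).trans hRg) (fun t ht => (Finset.mem_filter.1 ht).2) hA hR₁ hR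
    (Rw := Λ.rE a' (tgt e) du) (fun d hd => mem_graphBall_of_mem_VWin (hDE' hd)) fun d hd d' hd' => ?_
  exact P.sub_mem_box_of_mem_EfarN (φ_mem_of_mem_VWin (hDE' hd)) (φ_mem_of_mem_VWin (hDE' hd'))

end Skelφ

end Summit.CriticalPhenomena.PercolationContinuityZ3.Theorems.Transplant

end
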